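import Mathlib.Analysis.SpecialFunctions.Complex.Log
import Mathlib.Analysis.SpecialFunctions.ExpDeriv
import Mathlib.Analysis.Calculus.ContDiff.Deriv
import Mathlib.Analysis.Calculus.MeanValue
import Mathlib.MeasureTheory.Integral.IntervalIntegral.FundThmCalculus
import Mathlib.Topology.Order.ProjIcc
import HarnessLib

/-!
# `C¹` logarithms of non-vanishing `C¹` paths (winding numbers of `C¹` loops in `ℂ*`)

A general one-variable lemma, recorded as infrastructure for periods of curve type
(`Literature/NumberTheory/Transcendental/CurvePeriods.lean`, Huber–Wüstholz 2022, Thm. 13.3 (2)):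
the relative-homology relations (R5) of that rendering are boundaries of `C¹` triangles, and to
relate an arbitrary closed `C¹` path on `𝔾ₘ = {xy = 1}` to the standard loop `t ↦ e^{2πiwt}` one
needs a `C¹` lift of the path along `exp : ℂ → ℂ*` and its winding number `w`.

* `exists_contDiff_exp_eq` — a path `γ : [a, b] → ℂ ∖ {0}` of class `C¹` on `[a, b]` has a
  logarithm `L` of class `C¹` (on all of `ℝ`) with `exp ∘ L = γ` on `[a, b]`,
  `L(a) = log γ(a)` and `L′ = γ′/γ` on `[a, b]`. Construction: `L(t) = log γ(a) + ∫ₐᵗ γ′/γ`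
  (the integrand extended continuously to `ℝ` by the projection onto `[a, b]`); then
  `γ · e^{−L}` has zero derivative on `[a, b]`, hence is constant `= 1`.
* `exists_winding_number` — if moreover `γ(a) = γ(b)`, then `L(b) − L(a) = 2πi w` for an
  integer `w` (the winding number of the loop around `0`).

[folklore] (e.g. any text on the argument principle; Mathlib has the topological covering
`Complex.isCoveringMap_exp` but not this `C¹` statement).
-/

noncomputable section

open scoped Topology Real
open Set MeasureTheory Complex

namespace Literature.NumberTheory.Transcendental

namespace CurvePeriods

/-- **`C¹` logarithm of a non-vanishing `C¹` path.** For `γ` of class `C¹` on `[a, b]`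
(`a < b`) with `γ(t) ≠ 0` on `[a, b]` there is `L : ℝ → ℂ` of class `C¹` with
`L(a) = log γ(a)`, `L′(t) = γ′(t)/γ(t)` (one-sided derivatives on `[a, b]`) and
`exp (L t) = γ t` for all `t ∈ [a, b]`. [folklore] -/
theorem exists_contDiff_exp_eq {a b : ℝ} (hab : a < b) {γ : ℝ → ℂ}
    (hγ : ContDiffOn ℝ 1 γ (Icc a b)) (h0 : ∀ t ∈ Icc a b, γ t ≠ 0) :
    ∃ L : ℝ → ℂ, ContDiff ℝ 1 L ∧ L a = log (γ a) ∧
      (∀ t ∈ Icc a b, HasDerivAt L (derivWithin γ (Icc a b) t / γ t) t) ∧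
      ∀ t ∈ Icc a b, exp (L t) = γ t := by
  -- the logarithmic derivative, extended continuously to `ℝ`
  obtain ⟨g, hg⟩ : ∃ g : ℝ → ℂ, g = fun t => derivWithin γ (Icc a b) t / γ t := ⟨_, rfl⟩
  have hgc : ContinuousOn g (Icc a b) := by
    rw [hg]
    exact (hγ.continuousOn_derivWithin (uniqueDiffOn_Icc hab) le_rfl).div hγ.continuousOn h0
  obtain ⟨G, hG⟩ : ∃ G : ℝ → ℂ, G = fun t => g (projIcc a b hab.le t) := ⟨_, rfl⟩
  have hGc : Continuous G := by
    rw [hG]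
    exact hgc.comp_continuous (continuous_subtype_val.comp continuous_projIcc)
      fun t => (projIcc a b hab.le t).2
  have hGg : ∀ t ∈ Icc a b, G t = g t := fun t ht => by
    simp only [hG, projIcc_of_mem hab.le ht]
  -- the primitive
  obtain ⟨L, hL⟩ : ∃ L : ℝ → ℂ, L = fun t => log (γ a) + ∫ u in a..t, G u := ⟨_, rfl⟩
  have hLd : ∀ t, HasDerivAt L (G t) t := fun t => by
    rw [hL]
    exact ((hGc.integral_hasStrictDerivAt a t).hasDerivAt).const_add _
  have hLderiv : deriv L = G := funext fun t => (hLd t).deriv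
  have hLC1 : ContDiff ℝ 1 L :=
    contDiff_one_iff_deriv.2 ⟨fun t => (hLd t).differentiableAt, hLderiv ▸ hGc⟩
  have hLa : L a = log (γ a) := by simp [hL]
  refine ⟨L, hLC1, hLa, fun t ht => ?_, ?_⟩
  · have h := hLd t
    rwa [hGg t ht, hg] at h
  -- `q = γ · exp (−L)` is constant on `[a, b]`
  have hγd : ∀ t ∈ Icc a b, HasDerivWithinAt γ (derivWithin γ (Icc a b) t) (Icc a b) t :=
    fun t ht => ((hγ.differentiableOn one_ne_zero) t ht).hasDerivWithinAt
  have hq : ∀ t ∈ Icc a b, HasDerivWithinAt (fun t => γ t * exp (-L t)) 0 (Icc a b) t := by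
    intro t ht
    have h1 := hγd t ht
    have h2 : HasDerivWithinAt (fun t => exp (-L t)) (exp (-L t) * -(G t)) (Icc a b) t :=
      ((hLd t).hasDerivWithinAt.neg).cexp
    have h3 := h1.mul h2
    have hGt : G t = derivWithin γ (Icc a b) t / γ t := by rw [hGg t ht, hg]
    have hval : derivWithin γ (Icc a b) t * exp (-L t) + γ t * (exp (-L t) * -G t) = 0 := by
      rw [hGt]
      field_simp [h0 t ht]
      ring
    rwa [hval] at h3
  have hconst := constant_of_derivWithin_zero
    (fun t ht => (hq t ht).differentiableWithinAt)
    (fun t ht => (hq t (Ico_subset_Icc_self ht)).derivWithin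
      (uniqueDiffOn_Icc hab t (Ico_subset_Icc_self ht)))
  have ha : a ∈ Icc a b := left_mem_Icc.2 hab.le
  intro t ht
  have h : γ t * exp (-L t) = γ a * exp (-L a) := hconst t ht
  rw [hLa, exp_neg, exp_neg, exp_log (h0 a ha), mul_inv_cancel₀ (h0 a ha)] at h
  have hne : exp (L t) ≠ 0 := exp_ne_zero _
  calc exp (L t) = exp (L t) * (γ t * (exp (L t))⁻¹) := by rw [h, mul_one]
    _ = γ t := by rw [mul_comm, mul_assoc, inv_mul_cancel₀ hne, mul_one]

/-- **Winding number of a `C¹` loop in `ℂ*`.** If `γ` is `C¹` on `[a, b]`, non-vanishing, and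
closed (`γ(a) = γ(b)`), then for the logarithm `L` of `exists_contDiff_exp_eq` (indeed for any
continuous logarithm) `L(b) − L(a) = w · 2πi` with `w ∈ ℤ`. [folklore] -/
theorem exists_winding_number {a b : ℝ} (hab : a < b) {γ : ℝ → ℂ}
    (hγ : ContDiffOn ℝ 1 γ (Icc a b)) (h0 : ∀ t ∈ Icc a b, γ t ≠ 0) (hcl : γ a = γ b) :
    ∃ (L : ℝ → ℂ) (w : ℤ), ContDiff ℝ 1 L ∧
      (∀ t ∈ Icc a b, HasDerivAt L (derivWithin γ (Icc a b) t / γ t) t) ∧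
      (∀ t ∈ Icc a b, exp (L t) = γ t) ∧ L b = L a + w * (2 * π * I) := by
  obtain ⟨L, hC1, _, hder, hexp⟩ := exists_contDiff_exp_eq hab hγ h0
  have he : exp (L b) = exp (L a) := by
    rw [hexp b (right_mem_Icc.2 hab.le), hexp a (left_mem_Icc.2 hab.le), hcl]
  obtain ⟨w, hw⟩ := exp_eq_exp_iff_exists_int.1 he
  exact ⟨L, w, hC1, hder, hexp, hw⟩

end CurvePeriods

end Literature.NumberTheory.Transcendental

end
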